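import Literature.NumberTheory.Automorphic.TateLocalFactorsProofs
import Literature.NumberTheory.Automorphic.TateLocalFunctionalEquation
import HarnessLib

/-!
# Bookkeeping with Tate's `GL₁` Euler factors `P_χ = 1 - χ(ϖ) T` (line `Sketch_18745_r1_k1`,
crux `DyadicOddResidue.SectorComplement`, stmt-Langlands-18745; lead's stub
`stub_pair_eq_of_forall_tateEulerFactor_mul_eq` of the rank-2 attack on generic rigidity)

The rank-2 recovery compares two Frobenius-semisimple parameters through the Euler factors of
all their quasi-character twists; in the normal forms these are products of at most two Tate
factors `P_{αχ} = tateEulerFactor (α * χ)`.  This file is the elementary algebra of such data: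

* `tateEulerFactor_ne_one_iff` : `P_χ ≠ 1 ↔ χ` unramified; `natDegree P_χ ≤ 1`; `P_χ ≠ 0`;
* `QuasiChar.IsUnramified.eq_of_tateEulerFactor_eq` : an unramified `χ` is determined by `P_χ`;
* `eq_of_forall_tateEulerFactor_mul_eq` : `(∀ χ, P_{αχ} = P_{α'χ}) → α = α'`;
* `not_forall_tateEulerFactor_mul_eq_mul` : `P_{αχ} = P_{α'χ} P_{β'χ}` for all `χ` is impossible;
* `stub_pair_eq_of_forall_tateEulerFactor_mul_eq` : `(∀ χ, P_{αχ} P_{βχ} = P_{α'χ} P_{β'χ}) →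
  {α, β} = {α', β'}`.

References: J. Tate, *Fourier analysis in number fields and Hecke's zeta-functions* (1950), §2.4
(the local factor of a quasi-character). [Tate1950]
-/

noncomputable section

set_option linter.dupNamespace false

open Polynomial ValuativeRel
open Literature.NumberTheory.Automorphic Literature.NumberTheory.GaloisRepresentations
open Literature.NumberTheory.GaloisRepresentations.IsNonarchimedeanLocalField

namespace Summit.Langlands.Langlands.Theorems.ReciprocityRigidity

variable {F : Type} [Field F] [ValuativeRel F] [TopologicalSpace F] [IsNonarchimedeanLocalField F]

/-! ## One factor -/

/-- `P_χ = 1 - c X` with `c = χ(ϖ)` for unramified `χ` (any uniformiser `ϖ`). [cite: Tate1950, §2.4] -/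
theorem tateEulerFactor_eq_of_isUnramified {χ : QuasiChar F} (h : χ.IsUnramified) {ϖ : F}
    (hϖ : (valuation F).IsUniformizer ϖ) :
    tateEulerFactor χ = 1 - C ((χ (Units.mk0 ϖ hϖ.ne_zero) : ℂˣ) : ℂ) * X :=
  tateEulerFactor_of_isUnramified_holds h hϖ

/-- `1 - c X` has `X`-coefficient `-c`. [folklore] -/
theorem coeff_one_one_sub_C_mul_X (c : ℂ) : (1 - C c * X : ℂ[X]).coeff 1 = -c := by
  rw [coeff_sub, coeff_one, coeff_C_mul, coeff_X_one]
  simp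

/-- `1 - c X` has constant coefficient `1`. [folklore] -/
theorem coeff_zero_one_sub_C_mul_X (c : ℂ) : (1 - C c * X : ℂ[X]).coeff 0 = 1 := by
  rw [coeff_sub, coeff_one, coeff_C_mul, coeff_X_zero]
  simp

/-- `1 - c X` has `X²`-coefficient `0`. [folklore] -/
theorem coeff_two_one_sub_C_mul_X (c : ℂ) : (1 - C c * X : ℂ[X]).coeff 2 = 0 := by
  rw [coeff_sub, coeff_one, coeff_C_mul, coeff_X]
  simp

/-- `deg (1 - c X) = 1` for `c ≠ 0`. [folklore] -/
theorem natDegree_one_sub_C_mul_X {c : ℂ} (hc : c ≠ 0) : (1 - C c * X : ℂ[X]).natDegree = 1 := by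
  have : (1 - C c * X : ℂ[X]) = C (-c) * X + C 1 := by
    simp only [map_neg, map_one, neg_mul]
    ring
  rw [this, natDegree_linear (neg_ne_zero.2 hc)]

/-- The coefficient of `X` in `P_χ`: `-χ(ϖ)` if `χ` is unramified. [cite: Tate1950, §2.4] -/
theorem coeff_one_tateEulerFactor_of_isUnramified {χ : QuasiChar F} (h : χ.IsUnramified) {ϖ : F}
    (hϖ : (valuation F).IsUniformizer ϖ) :
    (tateEulerFactor χ).coeff 1 = -((χ (Units.mk0 ϖ hϖ.ne_zero) : ℂˣ) : ℂ) := by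
  rw [tateEulerFactor_eq_of_isUnramified h hϖ, coeff_one_one_sub_C_mul_X]

/-- `P_χ ≠ 1` iff `χ` is unramified. [cite: Tate1950, §2.4] -/
theorem tateEulerFactor_ne_one_iff {χ : QuasiChar F} : tateEulerFactor χ ≠ 1 ↔ χ.IsUnramified := by
  constructor
  · intro h
    by_contra hχ
    exact h (tateEulerFactor_of_not_isUnramified hχ)
  · intro h heq
    obtain ⟨ϖ, hϖ⟩ := Valuation.exists_isUniformizer_of_isCyclic_of_nontrivial (valuation F)
    have hc := coeff_one_tateEulerFactor_of_isUnramified h hϖ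
    rw [heq, coeff_one] at hc
    simp only [one_ne_zero, ↓reduceIte, zero_eq_neg, Units.ne_zero] at hc

/-- `deg P_χ = 1` for unramified `χ`. [cite: Tate1950, §2.4] -/
theorem natDegree_tateEulerFactor_of_isUnramified {χ : QuasiChar F} (h : χ.IsUnramified) :
    (tateEulerFactor χ).natDegree = 1 := by
  obtain ⟨ϖ, hϖ⟩ := Valuation.exists_isUniformizer_of_isCyclic_of_nontrivial (valuation F)
  rw [tateEulerFactor_eq_of_isUnramified h hϖ, natDegree_one_sub_C_mul_X (Units.ne_zero _)]

/-- `deg P_χ ≤ 1`. [cite: Tate1950, §2.4] -/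
theorem natDegree_tateEulerFactor_le (χ : QuasiChar F) : (tateEulerFactor χ).natDegree ≤ 1 := by
  by_cases h : χ.IsUnramified
  · rw [natDegree_tateEulerFactor_of_isUnramified h]
  · rw [tateEulerFactor_of_not_isUnramified h, natDegree_one]
    exact Nat.zero_le _

/-- `P_χ ≠ 0` (constant coefficient `1`). [cite: Tate1950, §2.4] -/
theorem tateEulerFactor_ne_zero (χ : QuasiChar F) : tateEulerFactor χ ≠ 0 := by
  by_cases h : χ.IsUnramified
  · obtain ⟨ϖ, hϖ⟩ := Valuation.exists_isUniformizer_of_isCyclic_of_nontrivial (valuation F)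
    intro h0
    have := congrArg (fun p : ℂ[X] => p.coeff 0) h0
    simp only [tateEulerFactor_eq_of_isUnramified h hϖ, coeff_zero_one_sub_C_mul_X,
      coeff_zero, one_ne_zero] at this
  · rw [tateEulerFactor_of_not_isUnramified h]
    exact one_ne_zero

/-- A product of two Tate factors is `1` only if both are. [folklore] -/
theorem tateEulerFactor_eq_one_of_mul_eq_one {χ χ' : QuasiChar F}
    (h : tateEulerFactor χ * tateEulerFactor χ' = 1) :
    tateEulerFactor χ = 1 ∧ tateEulerFactor χ' = 1 := by
  have hdeg := congrArg natDegree h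
  rw [natDegree_mul (tateEulerFactor_ne_zero _) (tateEulerFactor_ne_zero _), natDegree_one,
    Nat.add_eq_zero_iff] at hdeg
  constructor
  · by_contra hne
    have := natDegree_tateEulerFactor_of_isUnramified (tateEulerFactor_ne_one_iff.1 hne)
    omega
  · by_contra hne
    have := natDegree_tateEulerFactor_of_isUnramified (tateEulerFactor_ne_one_iff.1 hne)
    omega

/-- An unramified quasi-character is determined by its value at a uniformiser. [cite: Tate1950, §2.3] -/
theorem quasiChar_eq_of_apply_mk0_eq {χ χ' : QuasiChar F} (hχ : χ.IsUnramified)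
    (hχ' : χ'.IsUnramified) {ϖ : F} (hϖ : (valuation F).IsUniformizer ϖ)
    (h : χ (Units.mk0 ϖ hϖ.ne_zero) = χ' (Units.mk0 ϖ hϖ.ne_zero)) : χ = χ' := by
  refine ContinuousMonoidHom.ext fun x => ?_
  obtain ⟨k, hk⟩ := exists_valuation_eq_zpow_of_isUniformizer hϖ x
  have hx0 : (x : F) ≠ 0 := x.ne_zero
  have hϖk : ((Units.mk0 ϖ hϖ.ne_zero ^ k : Fˣ) : F) = ϖ ^ k := by simp
  have hval : valuation F (x : F) = valuation F ((Units.mk0 ϖ hϖ.ne_zero ^ k : Fˣ) : F) := by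
    rw [hϖk, hk, map_zpow₀]
  have hx : x = Units.mk0 (x : F) hx0 := by ext; rfl
  have hpk : (Units.mk0 ϖ hϖ.ne_zero ^ k : Fˣ) =
      Units.mk0 ((Units.mk0 ϖ hϖ.ne_zero ^ k : Fˣ) : F) (Units.ne_zero _) := by ext; rfl
  have e1 : χ x = χ (Units.mk0 ϖ hϖ.ne_zero) ^ k := by
    rw [← map_zpow, hpk, hx]
    exact hχ.apply_mk0_eq hx0 (Units.ne_zero _) hval
  have e2 : χ' x = χ' (Units.mk0 ϖ hϖ.ne_zero) ^ k := by
    rw [← map_zpow, hpk, hx]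
    exact hχ'.apply_mk0_eq hx0 (Units.ne_zero _) hval
  rw [e1, e2, h]

/-- An unramified quasi-character is determined by its Tate factor. [cite: Tate1950, §2.4] -/
theorem quasiChar_eq_of_tateEulerFactor_eq {χ χ' : QuasiChar F} (hχ : χ.IsUnramified)
    (h : tateEulerFactor χ = tateEulerFactor χ') : χ = χ' := by
  have hχ' : χ'.IsUnramified := by
    rw [← tateEulerFactor_ne_one_iff, ← h, tateEulerFactor_ne_one_iff]
    exact hχ
  obtain ⟨ϖ, hϖ⟩ := Valuation.exists_isUniformizer_of_isCyclic_of_nontrivial (valuation F)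
  refine quasiChar_eq_of_apply_mk0_eq hχ hχ' hϖ (Units.ext ?_)
  have h1 := coeff_one_tateEulerFactor_of_isUnramified hχ hϖ
  have h2 := coeff_one_tateEulerFactor_of_isUnramified hχ' hϖ
  rw [h, h2, neg_inj] at h1
  exact h1.symm

/-- The trivial quasi-character is unramified. [folklore] -/
theorem quasiChar_isUnramified_one : (1 : QuasiChar F).IsUnramified := fun _ _ => rfl

/-- Products of unramified quasi-characters are unramified. [folklore] -/
theorem quasiChar_isUnramified_mul {χ χ' : QuasiChar F} (hχ : χ.IsUnramified)
    (hχ' : χ'.IsUnramified) : (χ * χ').IsUnramified := fun x hx => by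
  change χ x * χ' x = 1
  rw [hχ x hx, hχ' x hx, one_mul]

/-! ## Comparing twist data -/

/-- **St vs St.**  If `P_{αχ} = P_{α'χ}` for every quasi-character `χ`, then `α = α'`
(test at `χ = α⁻¹`). [cite: Tate1950, §2.4] -/
theorem eq_of_forall_tateEulerFactor_mul_eq {α α' : QuasiChar F}
    (h : ∀ χ : QuasiChar F, tateEulerFactor (α * χ) = tateEulerFactor (α' * χ)) : α = α' := by
  have h1 := h α⁻¹
  rw [mul_inv_cancel] at h1
  have h2 : (1 : QuasiChar F) = α' * α⁻¹ :=
    quasiChar_eq_of_tateEulerFactor_eq quasiChar_isUnramified_one h1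
  exact (mul_inv_eq_one.1 h2.symm).symm

/-- **St vs sum is impossible.**  No quasi-characters satisfy `P_{αχ} = P_{α'χ} · P_{β'χ}` for
every `χ`: testing at `χ = α'⁻¹` and `χ = β'⁻¹` shows `αα'⁻¹`, `αβ'⁻¹` unramified, hence
`β'α'⁻¹` unramified, and then at `χ = α'⁻¹` the right side has degree `2 > 1`. [cite: Tate1950, §2.4] -/
theorem not_forall_tateEulerFactor_mul_eq_mul {α α' β' : QuasiChar F}
    (h : ∀ χ : QuasiChar F,
      tateEulerFactor (α * χ) = tateEulerFactor (α' * χ) * tateEulerFactor (β' * χ)) : False := by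
  -- `αχ` is unramified as soon as the right side is not `1`
  have key : ∀ χ : QuasiChar F,
      tateEulerFactor (α' * χ) * tateEulerFactor (β' * χ) ≠ 1 → (α * χ).IsUnramified := by
    intro χ hχ
    rw [← tateEulerFactor_ne_one_iff, h χ]
    exact hχ
  have hP1 : tateEulerFactor (1 : QuasiChar F) ≠ 1 :=
    tateEulerFactor_ne_one_iff.2 quasiChar_isUnramified_one
  have h1 : (α * α'⁻¹).IsUnramified := key α'⁻¹ (by
    rw [mul_inv_cancel]
    exact fun heq => hP1 (tateEulerFactor_eq_one_of_mul_eq_one heq).1)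
  have h2 : (α * β'⁻¹).IsUnramified := key β'⁻¹ (by
    rw [mul_inv_cancel]
    exact fun heq => hP1 (tateEulerFactor_eq_one_of_mul_eq_one heq).2)
  have h3 : (β' * α'⁻¹).IsUnramified := by
    have heq : β' * α'⁻¹ = (α * β'⁻¹)⁻¹ * (α * α'⁻¹) := by
      refine ContinuousMonoidHom.ext fun x => ?_
      change β' x * (α' x)⁻¹ = (α x * (β' x)⁻¹)⁻¹ * (α x * (α' x)⁻¹)
      group
    rw [heq]
    exact quasiChar_isUnramified_mul h2.inv h1
  -- degrees at `χ = α'⁻¹`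
  have hdeg := congrArg natDegree (h α'⁻¹)
  rw [natDegree_mul (tateEulerFactor_ne_zero _) (tateEulerFactor_ne_zero _), mul_inv_cancel,
    natDegree_tateEulerFactor_of_isUnramified quasiChar_isUnramified_one,
    natDegree_tateEulerFactor_of_isUnramified h3] at hdeg
  have := natDegree_tateEulerFactor_le (α * α'⁻¹)
  omega

/-- Expansion of a product of two linear Euler factors. [folklore] -/
theorem one_sub_mul_one_sub_eq (a b : ℂ) :
    ((1 - C a * X) * (1 - C b * X) : ℂ[X]) = C (a * b) * X ^ 2 - C (a + b) * X + 1 := by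
  simp only [map_mul, map_add]
  ring

/-- Vieta for two linear Euler factors: `(1 - aX)(1 - bX) = (1 - cX)(1 - dX)` forces
`{a, b} = {c, d}`. [folklore] -/
theorem pair_eq_of_one_sub_mul_eq {a b c d : ℂ}
    (h : (1 - C a * X) * (1 - C b * X) = ((1 - C c * X) * (1 - C d * X) : ℂ[X])) :
    (a = c ∧ b = d) ∨ (a = d ∧ b = c) := by
  rw [one_sub_mul_one_sub_eq, one_sub_mul_one_sub_eq] at h
  have hsum : a + b = c + d := by
    have := congrArg (fun p : ℂ[X] => p.coeff 1) h
    simp only [coeff_add, coeff_sub, coeff_C_mul, coeff_X_pow, coeff_X_one, coeff_one] at this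
    norm_num at this
    linear_combination -this
  have hprod : a * b = c * d := by
    have := congrArg (fun p : ℂ[X] => p.coeff 2) h
    simp only [coeff_add, coeff_sub, coeff_C_mul, coeff_X_pow, coeff_X, coeff_one] at this
    norm_num at this
    exact this
  have hfac : (a - c) * (a - d) = 0 := by linear_combination a * hsum - hprod
  rcases mul_eq_zero.1 hfac with hac | had
  · left
    refine ⟨sub_eq_zero.1 hac, ?_⟩
    linear_combination hsum - sub_eq_zero.1 hac
  · right
    refine ⟨sub_eq_zero.1 had, ?_⟩
    linear_combination hsum - sub_eq_zero.1 had

/-- One half of the sum-vs-sum comparison: if moreover `α'α⁻¹` is unramified.  [folklore] -/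
theorem pair_eq_of_forall_tateEulerFactor_mul_eq_aux {α β α' β' : QuasiChar F}
    (h : ∀ χ : QuasiChar F, tateEulerFactor (α * χ) * tateEulerFactor (β * χ) =
      tateEulerFactor (α' * χ) * tateEulerFactor (β' * χ))
    (hη : (α' * α⁻¹).IsUnramified) : (α = α' ∧ β = β') ∨ (α = β' ∧ β = α') := by
  obtain ⟨ϖ, hϖ⟩ := Valuation.exists_isUniformizer_of_isCyclic_of_nontrivial (valuation F)
  have hE := h α⁻¹
  rw [mul_inv_cancel] at hE
  -- how to finish once `α = α'`
  have finish_left : α' = α → (α = α' ∧ β = β') ∨ (α = β' ∧ β = α') := by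
    intro hαα'
    left
    refine ⟨hαα'.symm, ?_⟩
    apply eq_of_forall_tateEulerFactor_mul_eq
    intro χ
    have := h χ
    rw [hαα'] at this
    exact mul_left_cancel₀ (tateEulerFactor_ne_zero _) this
  by_cases hθ : (β * α⁻¹).IsUnramified
  · -- both left factors non-trivial: degree 2, so `β'α⁻¹` is unramified too, then Vieta
    have hθ' : (β' * α⁻¹).IsUnramified := by
      have hdeg := congrArg natDegree hE
      rw [natDegree_mul (tateEulerFactor_ne_zero _) (tateEulerFactor_ne_zero _),
        natDegree_mul (tateEulerFactor_ne_zero _) (tateEulerFactor_ne_zero _),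
        natDegree_tateEulerFactor_of_isUnramified quasiChar_isUnramified_one,
        natDegree_tateEulerFactor_of_isUnramified hθ,
        natDegree_tateEulerFactor_of_isUnramified hη] at hdeg
      rw [← tateEulerFactor_ne_one_iff]
      intro h1
      rw [h1, natDegree_one] at hdeg
      omega
    rw [tateEulerFactor_eq_of_isUnramified quasiChar_isUnramified_one hϖ,
      tateEulerFactor_eq_of_isUnramified hθ hϖ, tateEulerFactor_eq_of_isUnramified hη hϖ,
      tateEulerFactor_eq_of_isUnramified hθ' hϖ] at hE
    rcases pair_eq_of_one_sub_mul_eq hE with ⟨h1, h2⟩ | ⟨h1, h2⟩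
    · -- `η(ϖ) = 1`: `α' = α`
      refine finish_left ?_
      have : (1 : QuasiChar F) = α' * α⁻¹ :=
        quasiChar_eq_of_apply_mk0_eq quasiChar_isUnramified_one hη hϖ (Units.ext h1)
      exact mul_inv_eq_one.1 this.symm
    · -- `η(ϖ) = θ'... `: swapped
      right
      have hβ'α : β' = α := by
        have : (1 : QuasiChar F) = β' * α⁻¹ :=
          quasiChar_eq_of_apply_mk0_eq quasiChar_isUnramified_one hθ' hϖ (Units.ext h1)
        exact mul_inv_eq_one.1 this.symm
      have hβα' : β = α' := by
        have : β * α⁻¹ = α' * α⁻¹ := quasiChar_eq_of_apply_mk0_eq hθ hη hϖ (Units.ext h2)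
        calc β = β * α⁻¹ * α := by rw [inv_mul_cancel_right]
          _ = α' * α⁻¹ * α := by rw [this]
          _ = α' := by rw [inv_mul_cancel_right]
      exact ⟨hβ'α.symm, hβα'⟩
  · -- `P_{βα⁻¹} = 1`: the left side is `P_1`, of degree 1, so `P_{β'α⁻¹} = 1` and `P_1 = P_η`
    rw [tateEulerFactor_of_not_isUnramified hθ, mul_one] at hE
    have hθ' : ¬ (β' * α⁻¹).IsUnramified := by
      intro hθ'
      have hdeg := congrArg natDegree hE
      rw [natDegree_mul (tateEulerFactor_ne_zero _) (tateEulerFactor_ne_zero _),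
        natDegree_tateEulerFactor_of_isUnramified quasiChar_isUnramified_one,
        natDegree_tateEulerFactor_of_isUnramified hθ',
        natDegree_tateEulerFactor_of_isUnramified hη] at hdeg
      omega
    rw [tateEulerFactor_of_not_isUnramified hθ', mul_one] at hE
    refine finish_left ?_
    have : (1 : QuasiChar F) = α' * α⁻¹ :=
      quasiChar_eq_of_tateEulerFactor_eq quasiChar_isUnramified_one hE
    exact mul_inv_eq_one.1 this.symm

/-- **Stub TA (lead): sum vs sum.**  If `P_{αχ} P_{βχ} = P_{α'χ} P_{β'χ}` for every quasi-character
`χ`, then `{α, β} = {α', β'}`: at `χ = α⁻¹` the left side contains `P_1 ≠ 1`, so `α'α⁻¹` or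
`β'α⁻¹` is unramified, and `pair_eq_of_forall_tateEulerFactor_mul_eq_aux` (applied as is, or with
`α', β'` swapped) finishes. [cite: Tate1950, §2.4] -/
theorem stub_pair_eq_of_forall_tateEulerFactor_mul_eq {α β α' β' : QuasiChar F}
    (h : ∀ χ : QuasiChar F, tateEulerFactor (α * χ) * tateEulerFactor (β * χ) =
      tateEulerFactor (α' * χ) * tateEulerFactor (β' * χ)) :
    (α = α' ∧ β = β') ∨ (α = β' ∧ β = α') := by
  have hE := h α⁻¹
  rw [mul_inv_cancel] at hE
  have hne : tateEulerFactor (α' * α⁻¹) * tateEulerFactor (β' * α⁻¹) ≠ 1 := by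
    rw [← hE]
    intro h1
    exact tateEulerFactor_ne_one_iff.2 quasiChar_isUnramified_one
      (tateEulerFactor_eq_one_of_mul_eq_one h1).1
  by_cases hη : (α' * α⁻¹).IsUnramified
  · exact pair_eq_of_forall_tateEulerFactor_mul_eq_aux h hη
  · have hη' : (β' * α⁻¹).IsUnramified := by
      rw [← tateEulerFactor_ne_one_iff]
      intro h1
      rw [← tateEulerFactor_ne_one_iff, not_not] at hη
      exact hne (by rw [hη, h1, one_mul])
    have h' : ∀ χ : QuasiChar F, tateEulerFactor (α * χ) * tateEulerFactor (β * χ) =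
        tateEulerFactor (β' * χ) * tateEulerFactor (α' * χ) := fun χ => by rw [h χ, mul_comm]
    rcases pair_eq_of_forall_tateEulerFactor_mul_eq_aux h' hη' with ⟨h1, h2⟩ | ⟨h1, h2⟩
    · exact Or.inr ⟨h1, h2⟩
    · exact Or.inl ⟨h1, h2⟩

end Summit.Langlands.Langlands.Theorems.ReciprocityRigidity

end
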